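import Summits.QuantumFields.YangMills.Theorems.LuscherReductionTwistedTraceScalingBORecordSupport
import Summits.QuantumFields.YangMills.Theorems.LuscherReductionTwistedTraceScalingBODualProfile
import HarnessLib

/-!
# (C4-CORE γ, data) THREE β-POINTWISE FACTS THE hOD ASSEMBLY CONSUMES: the soft weight is bounded below on the support of `χ`, the support facts of
# `χ` in the shape of `…BODefectRecordSplit.record_defect_split`, and the slow window of a `φ` supported in `orbitDist < δ₁`
# (lane A of S-BASE, crux `TwistedTraceScaling` stmt-QuantumFields-20203, C4-CORE, the (OD) pen; `pub/ym-fleet/ym-luscher-20007-p1/HANDOFF-g20.md` (γ))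

★ `softWeight_ge_of_window` — `0 < χ U ≤ 1`, `gaugeAvg χ U ≥ N̄(1−κ) > 0` ⇒ `softWeight χ U ≥ N̄(1−κ)` (the `w₀` of `record_defect_split` / `…BODefect.defect_of_weight_lower_bound`);
★ `recordChi_support_split` — eventually in `β`, every `U` with `recordChi ≠ 0` lies in `orthoTubeSet` with slow window `(517/|Site|)·β^{-s}` and action `≤ β^{-2s}`
(the hypothesis `hsupp` of `record_defect_split` at `D = 517/|Site|`, from `…BORecordSupport.recordChi_support`);
★ `slow_window_of_orbitDist` — `orbitDist u < δ₁ ≤ δ` ⇒ `‖q(u_k) − 1‖ ≤ δ` (the hypothesis `hφw` of the tail / out pieces from the support clause of hOD).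
HONEST FRAMING: bookkeeping for a stub of a child of the CONDITIONAL route R2b1; the hOD assembly, (B-ST), C4-CORE remain OPEN; not a gap, not Clay.
-/

set_option autoImplicit false

noncomputable section

open Filter Topology Real
open Literature.MathematicalPhysics.QuantumFieldTheory
open Literature.MathematicalPhysics.QuantumLattice

namespace Summit.QuantumFields.YangMills.Theorems.FemtoTransferGap.TwoLattice.ConstTube

open Summit.QuantumFields.YangMills.Theorems.FemtoTransferGap
open Summit.QuantumFields.YangMills.Theorems.FemtoTransferGap.TwoLattice
open Summit.QuantumFields.YangMills.Theorems.FemtoTransferGap.TwoLattice.Avg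

variable {L : ℕ} [NeZero L]

/-- ★ **THE SOFT WEIGHT FROM BELOW ON THE SUPPORT**: `0 < χ U ≤ 1` and `N̄(1−κ) ≤ gaugeAvg χ U`, `0 < N̄(1−κ)` ⇒ `N̄(1−κ) ≤ softWeight χ U`. [folklore] -/
theorem softWeight_ge_of_window {χ : GaugeConfig 3 L SU2 → ℝ} {U : GaugeConfig 3 L SU2} (hχ0 : 0 < χ U) (hχ1 : χ U ≤ 1) {Nbar κ : ℝ}
    (hNκ : 0 < Nbar * (1 - κ)) (hN : Nbar * (1 - κ) ≤ gaugeAvg χ U) : Nbar * (1 - κ) ≤ softWeight χ U := by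
  rw [softWeight_eq_div, le_div_iff₀ hχ0]
  have hg0 : 0 ≤ gaugeAvg χ U := hNκ.le.trans hN
  calc Nbar * (1 - κ) * χ U ≤ Nbar * (1 - κ) * 1 := mul_le_mul_of_nonneg_left hχ1 hNκ.le
    _ ≤ gaugeAvg χ U := by rw [mul_one]; exact hN

/-- The same packaged for the record weight: on `{recordChi ≠ 0}`, given the FP window `N̄(1−κ) ≤ gaugeAvg χ` on the fat tube, `softWeight χ ≥ N̄(1−κ)`. [folklore] -/
theorem softWeight_recordChi_ge {s M β Nbar κ : ℝ} (hNκ : 0 < Nbar * (1 - κ))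
    (hPlo : ∀ U ∈ fatTubeRho L (fun β => 43 * powScale s β) (fun b => M * (43 * powScale s b)) β, Nbar * (1 - κ) ≤ gaugeAvg (recordChi L s 43 M β) U)
    (U : GaugeConfig 3 L SU2) (hU : recordChi L s 43 M β U ≠ 0) : Nbar * (1 - κ) ≤ softWeight (recordChi L s 43 M β) U := by
  obtain ⟨-, hχ1, hχ0, hχF⟩ := recordChi_props (L := L) s 43 M β
  have hpos : 0 < recordChi L s 43 M β U := lt_of_le_of_ne (hχ0 U) (Ne.symm hU)
  exact softWeight_ge_of_window hpos ((le_abs_self _).trans (hχ1 U)) hNκ (hPlo U (hχF U hU).2)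

/-- ★ **THE SUPPORT FACTS OF THE RECORD WEIGHT IN SPLIT SHAPE** (`s > 0`, `M ≥ 0`): eventually in `β`, every `U` with `recordChi ≠ 0` is in `orthoTubeSet` with slow window
`(517/|Site|)·β^{-s}` and action `≤ β^{-2s}`. [cite: Luscher1983, §3] -/
theorem recordChi_support_split {s : ℝ} (hs : 0 < s) {M : ℝ} (hM : 0 ≤ M) :
    ∀ᶠ β : ℝ in atTop, ∀ U : GaugeConfig 3 L SU2, recordChi L s 43 M β U ≠ 0 →
      U ∈ orthoTubeSet L ∧ (∀ k : Fin 3, ‖su2Quat (slowMean L U (0, k)) - 1‖ ≤ 517 / Fintype.card (Site 3 L) * powScale s β) ∧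
        (L : ℝ) ^ 3 * wilsonAction su2Rep (slowMean L U) ≤ powScale (2 * s) β := by
  filter_upwards [recordChi_support (L := L) hs hM] with β hβ U hU
  obtain ⟨-, -, hoT, hslow, hact⟩ := hβ U hU
  exact ⟨hoT, hslow, hact⟩

omit [NeZero L] in
/-- ★ `orbitDist u < δ₁ ≤ δ` ⇒ the slow window `‖q(u_k) − 1‖ ≤ δ` for every `k`. [folklore] -/
theorem slow_window_of_orbitDist {φ : GaugeConfig 3 1 SU2 → ℝ} {δ₁ δ : ℝ} (hδ : δ₁ ≤ δ) (hφs : ∀ u, φ u ≠ 0 → orbitDist u < δ₁) :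
    ∀ u, φ u ≠ 0 → ∀ k : Fin 3, ‖su2Quat (u (0, k)) - 1‖ ≤ δ := fun u hu k =>
  ((norm_su2Quat_sub_one_le_orbitDist u (0, k)).trans (hφs u hu).le).trans hδ

omit [NeZero L] in
/-- `14β^{-s}/|Site| ≤ (517/|Site|)·β^{-s}` (the record support radius `δ₁` is inside the slow window `D·β^{-s}`, `D = 517/|Site|`). [folklore] -/
theorem recordDelta_le_window (N : ℝ) (hN : 0 < N) (x : ℝ) (hx : 0 ≤ x) : 14 * x / N ≤ 517 / N * x := by
  rw [div_mul_eq_mul_div]; exact div_le_div_of_nonneg_right (by nlinarith) hN.le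

end Summit.QuantumFields.YangMills.Theorems.FemtoTransferGap.TwoLattice.ConstTube

end
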